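import Literature.AnabelianGeometry.AbsoluteAnabelian.AbsTopIII.CuspidalCyclotomeKummerUnitsClosureRefutations
import Literature.AnabelianGeometry.AbsoluteAnabelian.AbsTopIII.CurveModelSchemaWitnesses
import Literature.AnabelianGeometry.AbsoluteAnabelian.AbsTopIII.DivisorSectionsSchemaNegative
import Literature.AnabelianGeometry.AbsoluteAnabelian.AbsTopIII.KummerIntrinsicSchemaNegative
import Literature.AnabelianGeometry.AbsoluteAnabelian.AbsTopIII.KummerFaithfulPadicAbelianProofs
import HarnessLib

/-!
# [AbsTopIII] §1 Kummer schemata (FACT-LIST F-0342 / F-0343 / F-0344 / F-0345 / F-0351 / F-0374–F-0377):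
# the universal closures are FALSE — unconditionally

Mochizuki, *Topics in Absolute Anabelian Geometry III*, §1, Prop. 1.6 (i)–(iii) pp. 34–35 and
Prop. 1.8 (i), (ii) p. 36 (manuscript pages, lit key `paper:url-5493eb38cbb7`).  Proof-only companion
(cell abc-iut, D-0078 block F; seat f-078, tranche 78 = F-0343/F-0344/F-0345; the sibling rows by
courtesy of their closed seats f-077 (F-0342), L4-lead (F-0351), f-084 (F-0374–F-0377)).

Each of these rows is a predicate on a free INTERFACE (`KummerCurveModel`, `DivisorCurveModel`,
`IntrinsicKummerModel`); the sibling files refute its universal closure at an explicit junk model, but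
only MODULO the existence of one Kummer-faithful field ([AbsTopIII] Def. 1.5), the one hypothesis of the
rows a junk model cannot discharge (`…_of_isKummerFaithful`, `…_of_rmk_1_5_4_i`).  That field now EXISTS
in the kernel: `ℚ_2` is Kummer-faithful (`isKummerFaithful_padic`, abc-iut-f-085,
`KummerFaithfulPadicAbelianProofs`: `A(K)` is a profinite group in the strong topology —
`compactSpace_algPoints_of_isProper_holds`, `t2Space_algPoints_holds`,
`totallyDisconnectedSpace_algPoints` (abc-iut-f-070), `AbelianVariety.Points.instIsTopologicalGroup` — and a
profinite group has no divisible element, `DivisibleElementsTrivial.of_profinite`).  This file records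
the resulting UNCONDITIONAL refutations `¬ ∀ M, …` (one line each):

* F-0342 `Prop_1_6_i` (`KummerCurveModel`): `not_forall_prop_1_6_i`;
* F-0343 `Prop_1_6_iii_units`, F-0344 `Prop_1_8_i_units`, F-0345 `Prop_1_8_ii_units`
  (`KummerCurveModel`): `not_forall_prop_1_6_iii_units`, `not_forall_prop_1_8_i_units`,
  `not_forall_prop_1_8_ii_units`; and the closed forms are now plainly FALSE propositions
  (`forall_prop_1_6_iii_units_iff_false` etc., from gen-0's `…_iff_no_kummerFaithful`);
* F-0351 `DivisorCurveModel.Prop_1_6_ii`: `DivisorCurveModel.not_forall_prop_1_6_ii`;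
* F-0374 `IntrinsicKummerModel.Prop_1_6_i`, F-0375 `…Prop_1_6_iii_units`, F-0376 `…Prop_1_8_i_units`,
  F-0377 `…Prop_1_8_ii_units` (universe `0`): `IntrinsicKummerModel.not_forall_prop_1_6_i` etc.

Bookkeeping consequence only: these rows are SCHEMAS (class R5), consumable in instance form at the
genuine étale-`π₁` model and never as closed facts; binding any of them as a `∀`-closure hypothesis of a
conditional certificate makes that certificate vacuous.  Nothing here bears on the printed propositions
(junk models are not hyperbolic curves); no side is taken on [IUTchIII] Cor. 3.12; typed ≠ proved;
refuting a universal closure ≠ refuting print.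
-/

noncomputable section

namespace Literature.AnabelianGeometry.AbsoluteAnabelian.AbsTopIII

/-- A Kummer-faithful field of characteristic zero in `Type`: `ℚ_2` ([AbsTopIII] Rmk. 1.5.4 (i) p. 33,
MLF case; kernel: `isKummerFaithful_padic`). [cite: MochizukiAbsTopIII2015, Rmk 1.5.4 (i) p.33] -/
theorem isKummerFaithful_padicTwo : IsKummerFaithful ℚ_[2] :=
  isKummerFaithful_padic 2

/-! ### F-0342, F-0343, F-0344, F-0345 (`KummerCurveModel`) -/

/-- **F-0342: the universal closure of `Prop_1_6_i` is FALSE** (the toy Kummer model over the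
Kummer-faithful field `ℚ_2` has a non-injective Kummer map; `not_forall_prop_1_6_i_of_isKummerFaithful`).
[cite: MochizukiAbsTopIII2015, Prop 1.6 (i) p.34] -/
theorem not_forall_prop_1_6_i : ¬ ∀ M : KummerCurveModel.{0}, Prop_1_6_i M :=
  not_forall_prop_1_6_i_of_isKummerFaithful ℚ_[2] isKummerFaithful_padicTwo

/-- **F-0343: the universal closure of `Prop_1_6_iii_units` is FALSE** (junk model over `ℚ_2`,
`not_forall_prop_1_6_iii_units_of_isKummerFaithful`). [cite: MochizukiAbsTopIII2015, Prop 1.6 (iii) p.35] -/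
theorem not_forall_prop_1_6_iii_units : ¬ ∀ M : KummerCurveModel.{0}, Prop_1_6_iii_units M :=
  not_forall_prop_1_6_iii_units_of_isKummerFaithful isKummerFaithful_padicTwo

/-- **F-0344: the universal closure of `Prop_1_8_i_units` is FALSE** (junk model over `ℚ_2`,
`not_forall_prop_1_8_i_units_of_isKummerFaithful`). [cite: MochizukiAbsTopIII2015, Prop 1.8 (i) p.36] -/
theorem not_forall_prop_1_8_i_units : ¬ ∀ M : KummerCurveModel.{0}, Prop_1_8_i_units M :=
  not_forall_prop_1_8_i_units_of_isKummerFaithful isKummerFaithful_padicTwo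

/-- **F-0345: the universal closure of `Prop_1_8_ii_units` is FALSE** (junk model over `ℚ_2`,
`not_forall_prop_1_8_ii_units_of_isKummerFaithful`). [cite: MochizukiAbsTopIII2015, Prop 1.8 (ii) p.36] -/
theorem not_forall_prop_1_8_ii_units : ¬ ∀ M : KummerCurveModel.{0}, Prop_1_8_ii_units M :=
  not_forall_prop_1_8_ii_units_of_isKummerFaithful isKummerFaithful_padicTwo

/-- **The closed form of F-0343 is FALSE as a proposition**: gen-0's characterisation
`forall_prop_1_6_iii_units_iff_no_kummerFaithful` ("`∀ M, …` iff no field is Kummer-faithful") met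
with the Kummer-faithful field `ℚ_2`. [cite: MochizukiAbsTopIII2015, Prop 1.6 (iii) p.35] -/
theorem forall_prop_1_6_iii_units_iff_false :
    (∀ M : KummerCurveModel.{0}, Prop_1_6_iii_units M) ↔ False :=
  iff_false_intro not_forall_prop_1_6_iii_units

/-- **The closed form of F-0344 is FALSE as a proposition.** [cite: MochizukiAbsTopIII2015, Prop 1.8 (i) p.36] -/
theorem forall_prop_1_8_i_units_iff_false :
    (∀ M : KummerCurveModel.{0}, Prop_1_8_i_units M) ↔ False :=
  iff_false_intro not_forall_prop_1_8_i_units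

/-- **The closed form of F-0345 is FALSE as a proposition.** [cite: MochizukiAbsTopIII2015, Prop 1.8 (ii) p.36] -/
theorem forall_prop_1_8_ii_units_iff_false :
    (∀ M : KummerCurveModel.{0}, Prop_1_8_ii_units M) ↔ False :=
  iff_false_intro not_forall_prop_1_8_ii_units

/-- **No field (in `Type`) is a counter-model to Kummer-faithfulness of the closed schema**: the
right-hand side of gen-0's `forall_prop_1_6_iii_units_iff_no_kummerFaithful` fails at `ℚ_2`.
[cite: MochizukiAbsTopIII2015, Def 1.5 p.32] -/
theorem not_forall_not_isKummerFaithful : ¬ ∀ (k : Type) [Field k], ¬ IsKummerFaithful k :=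
  fun h => h ℚ_[2] isKummerFaithful_padicTwo

/-! ### F-0351 (`DivisorCurveModel`) -/

/-- **F-0351: the universal closure of `DivisorCurveModel.Prop_1_6_ii` is FALSE** (L4-lead's split
model over the Kummer-faithful field `ℚ_2`, `DivisorCurveModel.exists_not_prop_1_6_ii_of_isKummerFaithful`).
[cite: MochizukiAbsTopIII2015, Prop 1.6 (ii) p.35] -/
theorem DivisorCurveModel.not_forall_prop_1_6_ii :
    ¬ ∀ M : DivisorCurveModel.{0}, DivisorCurveModel.Prop_1_6_ii M := by
  obtain ⟨M, hM⟩ := DivisorCurveModel.exists_not_prop_1_6_ii_of_isKummerFaithful ℚ_[2]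
    isKummerFaithful_padicTwo
  exact fun H => hM (H M)

/-! ### F-0374, F-0375, F-0376, F-0377 (`IntrinsicKummerModel`, universe `0`) -/

/-- **F-0374: the universal closure of `IntrinsicKummerModel.Prop_1_6_i` is FALSE** (f-084's decision
`forall_prop_1_6_i_iff` met with the Kummer-faithful field `ℚ_2`).
[cite: MochizukiAbsTopIII2015, Prop 1.6 (i) p.34] -/
theorem IntrinsicKummerModel.not_forall_prop_1_6_i :
    ¬ ∀ M : IntrinsicKummerModel.{0}, IntrinsicKummerModel.Prop_1_6_i M :=
  IntrinsicKummerModel.not_forall_prop_1_6_i_of_isKummerFaithful isKummerFaithful_padicTwo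

/-- **F-0375: the universal closure of `IntrinsicKummerModel.Prop_1_6_iii_units` is FALSE.**
[cite: MochizukiAbsTopIII2015, Prop 1.6 (iii) p.35] -/
theorem IntrinsicKummerModel.not_forall_prop_1_6_iii_units :
    ¬ ∀ M : IntrinsicKummerModel.{0}, IntrinsicKummerModel.Prop_1_6_iii_units M :=
  IntrinsicKummerModel.not_forall_prop_1_6_iii_units_of_isKummerFaithful isKummerFaithful_padicTwo

/-- **F-0376: the universal closure of `IntrinsicKummerModel.Prop_1_8_i_units` is FALSE.**
[cite: MochizukiAbsTopIII2015, Prop 1.8 (i) p.36] -/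
theorem IntrinsicKummerModel.not_forall_prop_1_8_i_units :
    ¬ ∀ M : IntrinsicKummerModel.{0}, IntrinsicKummerModel.Prop_1_8_i_units M :=
  IntrinsicKummerModel.not_forall_prop_1_8_i_units_of_isKummerFaithful isKummerFaithful_padicTwo

/-- **F-0377: the universal closure of `IntrinsicKummerModel.Prop_1_8_ii_units` is FALSE.**
[cite: MochizukiAbsTopIII2015, Prop 1.8 (ii) p.36] -/
theorem IntrinsicKummerModel.not_forall_prop_1_8_ii_units :
    ¬ ∀ M : IntrinsicKummerModel.{0}, IntrinsicKummerModel.Prop_1_8_ii_units M :=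
  IntrinsicKummerModel.not_forall_prop_1_8_ii_units_of_isKummerFaithful isKummerFaithful_padicTwo

end Literature.AnabelianGeometry.AbsoluteAnabelian.AbsTopIII
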